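import Summits.Ventures.PercRepro.SixFourPLClass
import Summits.Ventures.PercRepro.SixFourPLListMem
import Summits.Ventures.PercRepro.SixFourT4LargeA

/-!
# PercRepro — C-025 at `(6,4)`, §22.12.1 (iii): the coarse profile of a plane-line set, part A (p3, gen 9)

mine-2's `MINE2-RLS.md` §22.12.1 (iii): the COARSE PROFILE `π(G) = (case, p, n, (inc₂, …, inc₇), (s_j))` of a
plane-line set `G` with normalisation `D : PLData M G` — the case (`meet` iff the line `ℓ = cl(L)` meets `ρ`), the
sizes `p = |ρ|`, `n = |L|`, the line-size vector `inc_m = #{lines of M with |ℓ ∩ ρ| = m}` (`inc` of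
`SixFourT4LargeA.lean`, 2-point lines included) and the class sizes `|λ_y|` over the distinct classes, listed in
non-increasing order.  This part defines `profile D` and proves the constraints of 22.12.5 that concern the sizes and
the line-size vector: `p ≤ 7`, `n ≥ 3`, `|ℓ ∩ G| = n + e ≤ 6` (hence `p ≥ 4` and `g ≤ 13`), the pair identity
`Σ_{m=2}^{7} C(m,2)·inc_m = C(p,2)` and `inc_m = 0` for `m ≥ p`.  Part B proves the class constraints.
-/

namespace PercRepro.SixFour

open Finset ThmH

variable {α : Type*} [DecidableEq α] {M : Matroid α} [M.Finite] {G : Finset α}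

namespace PLData

variable (D : PLData M G)

/-- The distinct classes of `D`: the `λ_y` over `y ∈ ρ ∖ ℓ`. -/
noncomputable def classes : Finset (Finset α) := (D.ρ \ D.ellF).image D.lam

/-- The class sizes in non-increasing order. -/
noncomputable def sizes : List ℕ := (Multiset.sort (D.classes.val.map Finset.card)).reverse

/-- Whether the line `ℓ` meets `ρ`. -/
noncomputable def meet : Bool := decide ((D.ellF ∩ D.ρ).card = 1)

/-- **The coarse profile of `D`** (22.12.1 (iii)). -/
noncomputable def profile : PL.CProf :=
  ⟨D.meet, D.ρ.card, D.L.card, (List.range 6).map (fun i => inc M D.ρ (i + 2)), D.sizes⟩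

variable {D}

/-- `ρ` has rank `3` (restated on `ρ`). -/
theorem eRk_ρ : M.eRk ((D.ρ : Finset α) : Set α) = 3 := D.rank_trace

/-- The class sizes are non-increasing. -/
theorem sizes_pairwise : D.sizes.Pairwise (· ≥ ·) := by
  unfold sizes
  rw [List.pairwise_reverse]
  exact Multiset.pairwise_sort _ _

/-- `ρ ∖ ℓ` is nonempty (`ρ` has rank `3` and meets `ℓ` in at most one point). -/
theorem ρ_sdiff_ellF_nonempty (hs : Simple M) (hG : G ⊆ gr M) (h2 : 2 ≤ D.L.card) :
    (D.ρ \ D.ellF).Nonempty := by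
  by_contra h
  rw [Finset.not_nonempty_iff_eq_empty, Finset.sdiff_eq_empty_iff_subset] at h
  have hsub : D.ρ ⊆ D.ellF ∩ D.P₀ := by
    intro y hy
    rw [Finset.mem_inter]
    exact ⟨h hy, (Finset.mem_inter.1 hy).1⟩
  have hc := (Finset.card_le_card hsub).trans (D.card_ellF_inter_le_one hs hG h2)
  have hr := D.rank_trace
  have hle : M.eRk ((D.ρ : Finset α) : Set α) ≤ 1 := by
    have := M.eRk_le_encard (D.ρ : Set α)
    rw [Set.encard_coe_eq_coe_finsetCard] at this
    exact this.trans (by exact_mod_cast hc)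
  unfold ρ at hle
  rw [hr] at hle
  exact absurd hle (by decide)

/-- `ℓ ∩ G = L ∪ (ℓ ∩ ρ)`. -/
theorem ellF_inter_G_eq (hs : Simple M) (hG : G ⊆ gr M) (h2 : 2 ≤ D.L.card) :
    D.ellF ∩ G = D.L ∪ (D.ellF ∩ D.ρ) := by
  ext y
  rw [Finset.mem_inter, Finset.mem_union, Finset.mem_inter]
  constructor
  · rintro ⟨hyℓ, hyG⟩
    by_cases hyP : y ∈ D.P₀
    · exact Or.inr ⟨hyℓ, Finset.mem_inter.2 ⟨hyP, hyG⟩⟩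
    · exact Or.inl (Finset.mem_sdiff.2 ⟨hyG, hyP⟩)
  · rintro (hyL | ⟨hyℓ, hyρ⟩)
    · exact ⟨D.L_subset_ellF hs hG h2 hyL, D.L_subset hyL⟩
    · exact ⟨hyℓ, D.ρ_subset hyρ⟩

/-- `|ℓ ∩ G| = n + |ℓ ∩ ρ|`. -/
theorem card_ellF_inter_G (hs : Simple M) (hG : G ⊆ gr M) (h2 : 2 ≤ D.L.card) :
    (D.ellF ∩ G).card = D.L.card + (D.ellF ∩ D.ρ).card := by
  rw [ellF_inter_G_eq hs hG h2, Finset.card_union_of_disjoint]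
  rw [Finset.disjoint_left]
  intro y hyL hy
  have hyρ := (Finset.mem_inter.1 hy).2
  unfold L at hyL
  unfold ρ at hyρ
  exact (Finset.mem_sdiff.1 hyL).2 (Finset.mem_inter.1 hyρ).1

/-- **`|ℓ ∩ G| ≤ 6`** (22.12.2 (d)): a plane `Π_y` with `y ∈ ρ ∖ ℓ` contains `(ℓ ∩ G) ∪ {y}`, at most `7` points. -/
theorem card_ellF_inter_G_le_six (hs : Simple M) (hG : G ⊆ gr M) (h2 : 2 ≤ D.L.card)
    (hpl : ∀ P ∈ planes M, (P ∩ G).card ≤ 7) : (D.ellF ∩ G).card ≤ 6 := by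
  obtain ⟨y, hy⟩ := ρ_sdiff_ellF_nonempty hs hG h2
  rw [Finset.mem_sdiff] at hy
  have hyG : y ∈ G := D.ρ_subset hy.1
  have hPi := Pi_mem_planes hs hG h2 hyG hy.2
  have hsub : insert y (D.ellF ∩ G) ⊆ D.Pi y ∩ G := by
    intro z hz
    rw [Finset.mem_insert] at hz
    rw [Finset.mem_inter]
    rcases hz with rfl | hz
    · exact ⟨hPi.2 (Finset.mem_insert_self _ _), hyG⟩
    · rw [Finset.mem_inter] at hz
      exact ⟨ellF_subset_Pi y hz.1, hz.2⟩
  have hyℓ : y ∉ D.ellF ∩ G := fun h => hy.2 (Finset.mem_inter.1 h).1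
  have h := (Finset.card_le_card hsub).trans (hpl _ hPi.1)
  rw [Finset.card_insert_of_notMem hyℓ] at h
  omega

/-- `n + e ≤ 6`, `4 ≤ p` and `g ≤ 13` (with `g ≥ 10`, `p ≤ 7`). -/
theorem size_facts (hs : Simple M) (hG : G ⊆ gr M) (hpl : ∀ P ∈ planes M, (P ∩ G).card ≤ 7)
    (hg : 10 ≤ G.card) :
    D.L.card + (D.ellF ∩ D.ρ).card ≤ 6 ∧ 4 ≤ D.ρ.card ∧ D.ρ.card ≤ 7 ∧ 3 ≤ D.L.card ∧ D.ρ.card + D.L.card ≤ 13 := by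
  have hp7 : D.ρ.card ≤ 7 := hpl _ D.plane
  have h3 := D.three_le_card_L hp7 hg
  have h6 := card_ellF_inter_G_le_six (D := D) hs hG (by omega) hpl
  rw [card_ellF_inter_G (D := D) hs hG (by omega)] at h6
  have hsum := D.card_ρ_add_card_L
  refine ⟨h6, by omega, hp7, h3, by omega⟩

/-- `e = |ℓ ∩ ρ|` as a number. -/
theorem e_profile_eq (hs : Simple M) (hG : G ⊆ gr M) (h2 : 2 ≤ D.L.card) :
    PL.e D.profile = (D.ellF ∩ D.ρ).card := by
  have h := D.card_ellF_inter_le_one hs hG h2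
  have hle : (D.ellF ∩ D.ρ).card ≤ (D.ellF ∩ D.P₀).card :=
    Finset.card_le_card (Finset.inter_subset_inter (Finset.Subset.refl _) Finset.inter_subset_left)
  unfold PL.e profile meet
  simp only
  by_cases h1 : (D.ellF ∩ D.ρ).card = 1
  · rw [if_pos (by simpa using h1), h1]
  · rw [if_neg (by simpa using h1)]
    omega

/-- The line-size vector of the profile: `inc_m = inc M ρ m` for `2 ≤ m ≤ 7`. -/
theorem inc_profile (i : ℕ) (hi : i < 6) : D.profile.inc.getD i 0 = inc M D.ρ (i + 2) := by
  unfold profile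
  simp only
  rw [List.getD_eq_getElem?_getD, List.getElem?_map, List.getElem?_range hi]
  rfl

/-- `inc_m = 0` for `m ≥ p`. -/
theorem inc_profile_eq_zero (i : ℕ) (hi : i < 6) (hp : D.ρ.card ≤ i + 2) : D.profile.inc.getD i 0 = 0 := by
  rw [inc_profile i hi]
  exact inc_eq_zero_of_card_le (eRk_ρ (D := D)) hp

/-- A list sum over `range n` is the finset sum. -/
theorem list_sum_range (f : ℕ → ℕ) : ∀ n : ℕ, ((List.range n).map f).sum = ∑ i ∈ Finset.range n, f i
  | 0 => by simp
  | n + 1 => by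
    rw [List.range_succ, List.map_append, List.sum_append, Finset.sum_range_succ, list_sum_range f n]
    simp

/-- **The pair identity of `ρ`**: `Σ_{m=2}^{7} C(m,2)·inc_m = C(p,2)` (`sum_choose_two_trace`). -/
theorem pair_identity_profile (hs : Simple M) (hG : G ⊆ gr M) (hp7 : D.ρ.card ≤ 7) :
    ((List.range 6).map fun i => PL.ch (i + 2) 2 * D.profile.inc.getD i 0).sum = PL.ch D.ρ.card 2 := by
  have hρ : D.ρ ⊆ gr M := D.ρ_subset.trans hG
  have key := sum_choose_two_trace hs hρ
  rw [sum_lines_eq_sum_inc D.ρ (fun m => m.choose 2), sum_inc_range_eight (eRk_ρ (D := D)) hp7] at key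
  rw [list_sum_range]
  have hch : ∀ n k, PL.ch n k = n.choose k := fun n k => by
    unfold PL.ch
    split_ifs with h
    · exact (Nat.choose_eq_factorial_div_factorial h).symm
    · exact (Nat.choose_eq_zero_of_lt (not_le.1 h)).symm
  simp only [hch]
  rw [← key]
  simp only [Finset.sum_range_succ, Finset.sum_range_zero, Nat.choose_zero_succ,
    show Nat.choose 1 2 = 0 from rfl]
  rw [inc_profile 0 (by norm_num), inc_profile 1 (by norm_num), inc_profile 2 (by norm_num),
    inc_profile 3 (by norm_num), inc_profile 4 (by norm_num), inc_profile 5 (by norm_num)]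
  ring

end PLData

end PercRepro.SixFour
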